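import Summits.RiemannHypothesis.RiemannHypothesis.Theorems.TiltedLandingLaw421R3SinkTemplate

/-!
# TiltedLandingLaw421R3 — «SinkKernelCone» (W-08 C1 scratch, rh-idea-5 g41): the quantitative cone lower bound
for the leading coefficient of the pair-kernel expansion

The «LIMIT LAW + REMAINDER LEMMA» shape ((CA1134), C3 RESULT-5) divides every menu quantity by the leading
coefficient `2·Re((u²)⁻¹)` of `farPairK u` («SinkKernelTail», slot 159). To turn the tail bounds
`‖pairTail u z‖ ≤ 4ρ²/‖u‖³`, `‖pairTail2 u w p‖ ≤ 20ρ/‖u‖³` into RELATIVE remainders one needs a LOWER bound of the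
same order `‖u‖⁻²` for `Re((u²)⁻¹)` on the far-zero region. On the cone `|Im u| ≤ κ·|Re u|` it is
`Re((u²)⁻¹) ≥ (1 − κ²)/((1 + κ²)·‖u‖²)`; in the sink geometry (far zero: `|Re u − xv| ≥ R/2`, `|Im u| ≤ Hs`,
thin strip `Hs ≤ κ·R/2`) this applies to `u − xv`. Pure algebra about points of ℂ; no `f`, no law. Sorry-free.
-/

namespace RhW08.SinkThin

open Complex
open scoped ComplexConjugate
open RhW08.SinkTemplate

section KernelCone

/-- CONE LOWER BOUND for the leading coefficient: `|Im u| ≤ κ|Re u|`, `u ≠ 0` ⇒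
`(1 − κ²)/((1 + κ²)‖u‖²) ≤ Re((u²)⁻¹)` (for `κ < 1` the left side is positive, of the exact order `‖u‖⁻²`). -/
theorem inv_sq_re_ge_of_cone (u : ℂ) (κ : ℝ) (hu : u ≠ 0) (hcone : |u.im| ≤ κ * |u.re|) :
    (1 - κ ^ 2) / ((1 + κ ^ 2) * ‖u‖ ^ 2) ≤ ((u ^ 2)⁻¹).re := by
  have hre : ((u ^ 2)⁻¹).re = (u.re ^ 2 - u.im ^ 2) / (Complex.normSq u) ^ 2 := by
    rw [Complex.inv_re, map_pow]
    congr 1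
    rw [sq, Complex.mul_re]
    ring
  have hN : ‖u‖ ^ 2 = Complex.normSq u := (Complex.normSq_eq_norm_sq u).symm
  have hn : 0 < Complex.normSq u := Complex.normSq_pos.mpr hu
  have hNdef : Complex.normSq u = u.re ^ 2 + u.im ^ 2 := by
    rw [Complex.normSq_apply]; ring
  have hκ : 0 ≤ κ := by
    by_contra hk
    have hk : κ < 0 := not_le.mp hk
    have h1 : κ * |u.re| ≤ 0 := mul_nonpos_of_nonpos_of_nonneg hk.le (abs_nonneg _)
    have h2 : |u.im| = 0 := le_antisymm (hcone.trans h1) (abs_nonneg _)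
    have h3 : u.im = 0 := abs_eq_zero.mp h2
    have h4 : |u.re| = 0 := by
      rcases (abs_nonneg u.re).lt_or_eq with h | h
      · exact absurd (hcone.trans_lt (by nlinarith)) (not_lt.mpr (abs_nonneg _))
      · exact h.symm
    exact hu (Complex.ext (abs_eq_zero.mp h4) h3)
  have hb : u.im ^ 2 ≤ κ ^ 2 * u.re ^ 2 := by
    have h1 : |u.im| ^ 2 ≤ (κ * |u.re|) ^ 2 := pow_le_pow_left₀ (abs_nonneg _) hcone 2
    rw [mul_pow, sq_abs, sq_abs] at h1
    exact h1
  rw [hre, hN, div_le_div_iff₀ (by positivity) (by positivity), hNdef]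
  have hprod : 0 ≤ (κ ^ 2 * u.re ^ 2 - u.im ^ 2) * (u.re ^ 2 + u.im ^ 2) :=
    mul_nonneg (sub_nonneg.mpr hb) (add_nonneg (sq_nonneg _) (sq_nonneg _))
  nlinarith [hprod]

/-- The same bound in the SINK GEOMETRY, for the translated far zero `u − xv`: `|Re u − xv| ≥ R/2 > 0`, `|Im u| ≤ Hs`,
`Hs ≤ κ·(R/2)` ⇒ `(1 − κ²)/((1 + κ²)‖u − xv‖²) ≤ Re(((u − xv)²)⁻¹)`. -/
theorem inv_sq_re_ge_of_far (u : ℂ) (xv R Hs κ : ℝ) (hR : 0 < R) (hre : R / 2 ≤ |u.re - xv|)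
    (him : |u.im| ≤ Hs) (hHs : Hs ≤ κ * (R / 2)) :
    (1 - κ ^ 2) / ((1 + κ ^ 2) * ‖u - xv‖ ^ 2) ≤ (((u - xv) ^ 2)⁻¹).re := by
  have hκ : 0 ≤ κ := by
    have h0 : 0 ≤ κ * (R / 2) := (abs_nonneg _).trans (him.trans hHs)
    nlinarith
  have h1 : (u - (xv : ℂ)).re = u.re - xv := by simp
  have h2 : (u - (xv : ℂ)).im = u.im := by simp
  have hne : u - (xv : ℂ) ≠ 0 := by
    intro h0
    have : (u - (xv : ℂ)).re = 0 := by rw [h0]; simp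
    rw [h1] at this
    rw [this, abs_zero] at hre
    linarith
  apply inv_sq_re_ge_of_cone (u - xv) κ hne
  rw [h1, h2]
  calc |u.im| ≤ Hs := him
    _ ≤ κ * (R / 2) := hHs
    _ ≤ κ * |u.re - xv| := mul_le_mul_of_nonneg_left hre hκ

/-- RELATIVE form used by a remainder lemma: a tail bounded by `T/‖u‖³` is at most
`T·(1 + κ²)/((1 − κ²)‖u‖)` times the leading coefficient `Re((u²)⁻¹)`, for `κ < 1`. -/
theorem tail_le_mul_inv_sq_re (u : ℂ) (κ T : ℝ) (hκ1 : κ < 1) (hT : 0 ≤ T) (hu : u ≠ 0)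
    (hcone : |u.im| ≤ κ * |u.re|) :
    T / ‖u‖ ^ 3 ≤ (T * (1 + κ ^ 2) / ((1 - κ ^ 2) * ‖u‖)) * ((u ^ 2)⁻¹).re := by
  have hu0 : 0 < ‖u‖ := norm_pos_iff.mpr hu
  have hκ : 0 ≤ κ := by
    by_contra hk
    have hk : κ < 0 := not_le.mp hk
    have h1 : κ * |u.re| ≤ 0 := mul_nonpos_of_nonpos_of_nonneg hk.le (abs_nonneg _)
    have h3 : u.im = 0 := abs_eq_zero.mp (le_antisymm (hcone.trans h1) (abs_nonneg _))
    have h4 : |u.re| = 0 := by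
      rcases (abs_nonneg u.re).lt_or_eq with h | h
      · exact absurd (hcone.trans_lt (by nlinarith)) (not_lt.mpr (abs_nonneg _))
      · exact h.symm
    exact hu (Complex.ext (abs_eq_zero.mp h4) h3)
  have hk2 : 0 < 1 - κ ^ 2 := by nlinarith
  have hc := inv_sq_re_ge_of_cone u κ hu hcone
  have hcoef : 0 ≤ T * (1 + κ ^ 2) / ((1 - κ ^ 2) * ‖u‖) := by positivity
  calc T / ‖u‖ ^ 3 = (T * (1 + κ ^ 2) / ((1 - κ ^ 2) * ‖u‖)) * ((1 - κ ^ 2) / ((1 + κ ^ 2) * ‖u‖ ^ 2)) := by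
        field_simp
    _ ≤ (T * (1 + κ ^ 2) / ((1 - κ ^ 2) * ‖u‖)) * ((u ^ 2)⁻¹).re := mul_le_mul_of_nonneg_left hc hcoef

end KernelCone

end RhW08.SinkThin
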